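import Summits.QuantumFields.YangMills.Theorems.LuscherReductionTwistedTraceScalingToronCoercive
import Summits.QuantumFields.YangMills.Theorems.LuscherReductionTwistedTraceScalingRiccatiZPE
import HarnessLib

/-!
# SECOND-ORDER SOFTNESS: near a gapped background the soft Gram eigenvalues of the covariant curl are `≤ 2‖D_U − D_V‖²`
# (lane A of S-BASE, crux `TwistedTraceScaling` stmt-QuantumFields-20203; k = 0 FLOOR, design note `pub/ym-fleet/ym-luscher-20007-p1/COARSE-DESIGN.md` §18)

The k = 0 floor needs, at a point `U` of the vacuum tube (`‖D_U − D_1̄‖ ≤ ε = O(τ)`), that every SOFT normal mode of the Riccati trial state (Gram eigenvalue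
`λᵢ(U) < μ`, where the weight is capped) is a perturbed ZERO mode of `D_1̄` with `λᵢ(U) = O(ε²)` — second order, not the first-order Weyl bound `O(ε)`.  This is
the elementary kernel-perturbation estimate for the PSD form `‖D·‖²` off a GAPPED background (`‖D_V x‖²` has values `0` or `≥ g₀` in every diagonalising frame):
* §1 `norm_adjoint_le_of_norm_le` — `‖A x‖ ≤ ε‖x‖ ∀x ⇒ ‖A† y‖ ≤ ε‖y‖`;
* §2 ★★ `Frame.IsDiag.soft_value_le` — if `(f, a)` diagonalises `‖D_V·‖²` with `aⱼ = 0 ∨ g₀ ≤ aⱼ`, `(e, λ)` is an eigenframe of `D†D`, `‖(D − D_V)x‖ ≤ ε‖x‖`, and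
  `2(√μ + ε)² ≤ g₀`, then EVERY `λᵢ < μ` satisfies `λᵢ ≤ 2ε²`.  Proof: the unit eigenvector `v = eᵢ` has `‖D_V v‖ ≤ √λᵢ + ε`, so by coercivity its mass on the
  zero modes of `D_V` is `K² ≥ 1 − (√λᵢ+ε)²/g₀ ≥ ½`; and for a zero mode `fⱼ` of `D_V`, `λᵢ⟨fⱼ,v⟩ = ⟨Dfⱼ, Dv⟩ = ⟨(D−D_V)fⱼ, Dv⟩ = ⟨fⱼ, (D−D_V)†Dv⟩`, whence
  `λᵢ²K² ≤ ‖(D−D_V)†Dv‖² ≤ ε²λᵢ` (Bessel), i.e. `λᵢ ≤ ε²/K² ≤ 2ε²`;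
* §3 ★★ `gram_soft_le_of_near_vacuum` — at the classical vacuum of the `L³` torus (`L ≥ 2`, stiff gap `g₀ = 2 − 2cos(2π/L)` by `Frame.IsDiag.value_zero_or_ge`):
  `‖D_U x − D_1̄ x‖ ≤ ε‖x‖ ∀x`, `2(√μ+ε)² ≤ 2 − 2cos(2π/L)` ⇒ every Gram eigenvalue of `D_U` below `μ` is `≤ 2ε²`.
HONEST FRAMING: finite-dimensional linear algebra for a stub lane of a child of the CONDITIONAL reduction route (femto rung R2b1); not infinite volume, not a gap,
not Clay.

## References
* R. A. Horn, C. R. Johnson, *Matrix Analysis* (2nd ed., 2013), Thm 4.1.5, Thm 7.3.2. [HornJohnson2013]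
* M. Lüscher, Nucl. Phys. B219 (1983) 233, §3. [Luscher1983]
-/

set_option autoImplicit false

noncomputable section

open Finset Real Module
open scoped BigOperators InnerProductSpace RealInnerProductSpace
open Literature.MathematicalPhysics.QuantumFieldTheory
open Literature.MathematicalPhysics.QuantumLattice

namespace Summit.QuantumFields.YangMills.Theorems.FemtoTransferGap.TwoLattice.Toron

open Summit.QuantumFields.YangMills.Theorems.FemtoTransferGap
open Summit.QuantumFields.YangMills.Theorems.FemtoTransferGap.TwoLattice
open Summit.QuantumFields.YangMills.Theorems.FemtoTransferGap.TwoLattice.Stiff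
open Summit.QuantumFields.YangMills.Theorems.FemtoTransferGap.TwoLattice.Cov
open Summit.QuantumFields.YangMills.Theorems.FemtoTransferGap.TwoLattice.Harm

section Abstract

variable {E F : Type*} [NormedAddCommGroup E] [InnerProductSpace ℝ E] [NormedAddCommGroup F] [InnerProductSpace ℝ F]
  [FiniteDimensional ℝ E] [FiniteDimensional ℝ F]
variable {ι ι' : Type*} [Fintype ι] [Fintype ι'] [DecidableEq ι] [DecidableEq ι']

/-! ## §1 The adjoint inherits an operator bound -/

/-- `‖A x‖ ≤ ε‖x‖` for all `x` (`ε ≥ 0`) implies `‖A† y‖ ≤ ε‖y‖` for all `y` (`‖A†y‖² = ⟨A A†y, y⟩ ≤ ε‖A†y‖‖y‖`). [cite: HornJohnson2013, Thm 4.1.5] -/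
theorem norm_adjoint_le_of_norm_le {A : E →ₗ[ℝ] F} {ε : ℝ} (hε : 0 ≤ ε) (hA : ∀ x, ‖A x‖ ≤ ε * ‖x‖) (y : F) :
    ‖A.adjoint y‖ ≤ ε * ‖y‖ := by
  set z := A.adjoint y with hz
  have h1 : ‖z‖ ^ 2 = ⟪A z, y⟫_ℝ := by
    rw [← real_inner_self_eq_norm_sq, hz, LinearMap.adjoint_inner_left]
    exact real_inner_comm _ _
  have h2 : ‖z‖ ^ 2 ≤ ε * ‖z‖ * ‖y‖ := by
    rw [h1]
    refine (real_inner_le_norm _ _).trans ?_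
    exact mul_le_mul_of_nonneg_right (hA z) (norm_nonneg y)
  by_cases hz0 : ‖z‖ = 0
  · rw [hz0]; positivity
  · have hzpos : 0 < ‖z‖ := lt_of_le_of_ne (norm_nonneg _) (Ne.symm hz0)
    nlinarith

/-! ## §2 Second-order softness off a gapped background -/

omit [FiniteDimensional ℝ E] [FiniteDimensional ℝ F] in
/-- A zero value of a diagonalising frame is a zero mode: `aⱼ = 0 ⇒ D fⱼ = 0`. [folklore] -/
theorem Frame.IsDiag.apply_eq_zero_of_value {D : E →ₗ[ℝ] F} {f : OrthonormalBasis ι' ℝ E} {a : ι' → ℝ} (h : Frame.IsDiag D f a) {j : ι'}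
    (hj : a j = 0) : D (f j) = 0 := by
  have h1 := h j j
  rw [if_pos rfl, hj] at h1
  have h2 : ⟪D (f j), D (f j)⟫_ℝ = 0 := by exact_mod_cast h1
  exact inner_self_eq_zero.mp h2

omit [DecidableEq ι] in
/-- ★★ **SECOND-ORDER SOFTNESS.**  Let `(f, a)` diagonalise `‖D_V·‖²` with the dichotomy `aⱼ = 0 ∨ g₀ ≤ aⱼ`, let `(e, λ)` be an eigenframe of `D†D`
(`D†D eᵢ = λᵢ eᵢ`), let `‖D x − D_V x‖ ≤ ε‖x‖` for all `x` (`ε ≥ 0`), and let `2(√μ + ε)² ≤ g₀`.  Then every `λᵢ < μ` satisfies `λᵢ ≤ 2ε²`.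
[cite: HornJohnson2013, Thm 4.1.5] [cite: Luscher1983, §3] -/
theorem Frame.IsDiag.soft_value_le {D D₀ : E →ₗ[ℝ] F} {f : OrthonormalBasis ι' ℝ E} {a : ι' → ℝ} (h₀ : Frame.IsDiag D₀ f a)
    {g₀ : ℝ} (hdich : ∀ j, a j = 0 ∨ g₀ ≤ a j) {e : OrthonormalBasis ι ℝ E} {lam : ι → ℝ} (hD : ∀ i, D.adjoint (D (e i)) = lam i • e i)
    {ε μ : ℝ} (hε : 0 ≤ ε) (hE : ∀ x, ‖D x - D₀ x‖ ≤ ε * ‖x‖) (hgap : 2 * (Real.sqrt μ + ε) ^ 2 ≤ g₀)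
    {i : ι} (hi : lam i < μ) : lam i ≤ 2 * ε ^ 2 := by
  set v := e i with hv
  set l := lam i with hl
  have hv1 : ‖v‖ = 1 := e.orthonormal.1 i
  have hl0 : 0 ≤ l := eigenvalue_nonneg hD i
  have hlv : l = ‖D v‖ ^ 2 := eigenvalue_eq_norm_sq hD i
  have hDv : ‖D v‖ = Real.sqrt l := by rw [hlv, Real.sqrt_sq (norm_nonneg _)]
  -- `μ > 0`, `g₀ > 0`
  have hμpos : 0 < μ := lt_of_le_of_lt hl0 hi
  have hg₀ : 0 < g₀ := by
    have : 0 < Real.sqrt μ + ε := by positivity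
    nlinarith
  -- `‖D₀ v‖ ≤ √l + ε`
  have hD₀v : ‖D₀ v‖ ≤ Real.sqrt l + ε := by
    have h1 : D₀ v = D v - (D v - D₀ v) := by abel
    rw [h1]
    refine (norm_sub_le _ _).trans ?_
    rw [hDv]
    have := hE v
    rw [hv1, mul_one] at this
    linarith
  -- mass on the zero modes of `D₀`: `K² ≥ 1/2`
  set Z := univ.filter (fun j => a j = 0) with hZ
  set K2 : ℝ := ∑ j ∈ Z, ⟪f j, v⟫_ℝ ^ 2 with hK2
  have hcoer := h₀.norm_sq_ge_of_dichotomy hdich v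
  rw [hv1, one_pow] at hcoer
  have hK2ge : 1 / 2 ≤ K2 := by
    -- `g₀(1 − K²) ≤ ‖D₀v‖² ≤ (√l+ε)² ≤ (√μ+ε)² ≤ g₀/2`
    have h1 : ‖D₀ v‖ ^ 2 ≤ (Real.sqrt l + ε) ^ 2 := pow_le_pow_left₀ (norm_nonneg _) hD₀v 2
    have h2 : Real.sqrt l ≤ Real.sqrt μ := Real.sqrt_le_sqrt hi.le
    have h3 : (Real.sqrt l + ε) ^ 2 ≤ (Real.sqrt μ + ε) ^ 2 :=
      pow_le_pow_left₀ (by positivity) (by linarith) 2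
    have h4 : g₀ * (1 - K2) ≤ g₀ / 2 := by linarith
    have h5 : 1 - K2 ≤ 1 / 2 := by
      by_contra hcon
      push Not at hcon
      nlinarith
    linarith
  -- zero modes: `l·⟨fⱼ, v⟩ = ⟨fⱼ, (D − D₀)† (D v)⟩`
  set Ed : E →ₗ[ℝ] F := D - D₀ with hEd
  have hEd_apply : ∀ x, Ed x = D x - D₀ x := fun x => by rw [hEd, LinearMap.sub_apply]
  have hEd_le : ∀ x, ‖Ed x‖ ≤ ε * ‖x‖ := fun x => by rw [hEd_apply]; exact hE x
  have hzero : ∀ j ∈ Z, l * ⟪f j, v⟫_ℝ = ⟪f j, Ed.adjoint (D v)⟫_ℝ := by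
    intro j hj
    have hj0 : a j = 0 := (mem_filter.mp hj).2
    have hDf : D₀ (f j) = 0 := h₀.apply_eq_zero_of_value hj0
    have h1 : ⟪f j, D.adjoint (D v)⟫_ℝ = l * ⟪f j, v⟫_ℝ := by
      rw [hv, hD i, inner_smul_right]
    rw [← h1, LinearMap.adjoint_inner_right, LinearMap.adjoint_inner_right, hEd_apply, hDf, sub_zero]
  -- `l²K² ≤ ε² l`
  have hkey : l ^ 2 * K2 ≤ ε ^ 2 * l := by
    have h1 : l ^ 2 * K2 = ∑ j ∈ Z, ⟪f j, Ed.adjoint (D v)⟫_ℝ ^ 2 := by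
      rw [hK2, Finset.mul_sum]
      refine Finset.sum_congr rfl fun j hj => ?_
      rw [← hzero j hj]; ring
    have h2 : ∑ j ∈ Z, ⟪f j, Ed.adjoint (D v)⟫_ℝ ^ 2 ≤ ∑ j, ⟪f j, Ed.adjoint (D v)⟫_ℝ ^ 2 :=
      Finset.sum_le_sum_of_subset_of_nonneg (Finset.filter_subset _ _) fun j _ _ => sq_nonneg _
    have h3 : ∑ j, ⟪f j, Ed.adjoint (D v)⟫_ℝ ^ 2 = ‖Ed.adjoint (D v)‖ ^ 2 := (norm_sq_eq_sum_coord f _).symm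
    have h4 : ‖Ed.adjoint (D v)‖ ≤ ε * ‖D v‖ := norm_adjoint_le_of_norm_le hε hEd_le (D v)
    have h5 : ‖Ed.adjoint (D v)‖ ^ 2 ≤ (ε * ‖D v‖) ^ 2 := pow_le_pow_left₀ (norm_nonneg _) h4 2
    rw [h1]
    calc ∑ j ∈ Z, ⟪f j, Ed.adjoint (D v)⟫_ℝ ^ 2 ≤ ‖Ed.adjoint (D v)‖ ^ 2 := h2.trans h3.le
      _ ≤ (ε * ‖D v‖) ^ 2 := h5
      _ = ε ^ 2 * l := by rw [mul_pow, ← hlv]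
  -- conclude
  by_cases hl00 : l = 0
  · rw [hl00]; positivity
  · have hlpos : 0 < l := lt_of_le_of_ne hl0 (Ne.symm hl00)
    have h1 : l * K2 ≤ ε ^ 2 := by
      have : l * (l * K2) ≤ l * ε ^ 2 := by nlinarith
      exact le_of_mul_le_mul_left this hlpos
    nlinarith

end Abstract

/-! ## §3 At the classical vacuum of the torus -/

variable (L : ℕ) [NeZero L]

omit [NeZero L] in
/-- The constant configuration `abelianCfg L 0` is the classical vacuum `1̄`. [folklore] -/
theorem abelianCfg_zero_eq_one : abelianCfg L 0 = 1 := by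
  funext e
  simp [abelianCfg, diagSU2_zero]

/-- ★ The dichotomy at the vacuum: every frame diagonalising `‖D_1̄·‖²` has values `0` or `≥ 2 − 2cos(2π/L)` (`L ≥ 2`). [cite: Luscher1983, §3] -/
theorem Frame.IsDiag.value_zero_or_ge_vacuum (hL : 2 ≤ L) {ι : Type*} [Fintype ι] [DecidableEq ι] {e : OrthonormalBasis ι ℝ (LinkSpace L)}
    {a : ι → ℝ} (h : Frame.IsDiag (covCurl (1 : GaugeConfig 3 L SU2)) e a) (i : ι) :
    a i = 0 ∨ 2 - 2 * Real.cos (2 * Real.pi / L) ≤ a i := by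
  rw [← abelianCfg_zero_eq_one L] at h
  have hch : ∀ j : Fin 3 → Fin L, lap3 L (fun k => 2 * (0 : Fin 3 → ℝ) k) j = 0 ∨
      2 - 2 * Real.cos (2 * Real.pi / L) ≤ lap3 L (fun k => 2 * (0 : Fin 3 → ℝ) k) j := by
    have h0 : (fun k : Fin 3 => 2 * (0 : Fin 3 → ℝ) k) = 0 := by funext k; simp
    rw [h0]
    exact lap3_zero_dichotomy L hL
  exact h.value_zero_or_ge L hL hch le_rfl i

variable {L}

/-- ★★ **SECOND-ORDER SOFTNESS AT THE VACUUM TUBE.**  For `L ≥ 2`, `ε ≥ 0` with `‖D_U x − D_1̄ x‖ ≤ ε‖x‖` for all `x`, and `μ` with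
`2(√μ + ε)² ≤ 2 − 2cos(2π/L)`: every Gram eigenvalue of `D_U` below `μ` is `≤ 2ε²`. [cite: HornJohnson2013, Thm 4.1.5] [cite: Luscher1983, §3] -/
theorem gram_soft_le_of_near_vacuum (hL : 2 ≤ L) (U : GaugeConfig 3 L SU2) {ε μ : ℝ} (hε : 0 ≤ ε)
    (hE : ∀ x, ‖covCurl U x - covCurl (1 : GaugeConfig 3 L SU2) x‖ ≤ ε * ‖x‖)
    (hgap : 2 * (Real.sqrt μ + ε) ^ 2 ≤ 2 - 2 * Real.cos (2 * Real.pi / L)) (i : Edge 3 L × Fin 3)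
    (hi : (gramMatrix_isHermitian (covCurl U)).eigenvalues i < μ) :
    (gramMatrix_isHermitian (covCurl U)).eigenvalues i ≤ 2 * ε ^ 2 := by
  classical
  have h₀ := Frame.isDiag_gramEigenvectorBasis (covCurl (1 : GaugeConfig 3 L SU2))
  have hdich := fun j => Frame.IsDiag.value_zero_or_ge_vacuum L hL h₀ j
  exact h₀.soft_value_le hdich (fun j => gram_frame (covCurl U) j) hε hE hgap hi

end Summit.QuantumFields.YangMills.Theorems.FemtoTransferGap.TwoLattice.Toron

end
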